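import Summits.KontsevichZagierPeriods.KontsevichZagierPeriods.Theorems.PentagonInKZ.Negative.WeightFourShape
import Summits.KontsevichZagierPeriods.KontsevichZagierPeriods.Theorems.PentagonInKZ.Negative.WeightThreeTightness

/-!
# `PentagonInKZ` — negative lane, §18d: the linearised level-4 pentagon identity

Standing adversary (cdisprove seat, generation 3) on the crux `PentagonInKZ`
(stmt-KontsevichZagierPeriods-11348).

* §18d For ANY series `φ` with the regularised shape in weight `≤ 4` (§16b, §18a–b) the level-4
  pentagon identity is `c·D[K₂] + p·D[U] + q·D[V] + α₁·D[L₁] + α₃₁·D[W₃₁] + α₂₂·D[K₂²] +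
  α₂₁₁·D[L₃] + c²·X = 0` (`pentAt_four_iff_of_shape`): linear in the coefficients except for the
  quadratic cross term `c²·X` of the two/three factors.
  Also: naturality and homogeneity of the patterns and the action of the scaling endomorphisms
  `σ_c` on the defect functionals (`scale_pentD`, `scale_pentX`) — the weight-separation tool of
  `Negative/WeightFourTightness.lean`, where the universal identities `D[U] = D[V]`,
  `10·X = 4D[L₁] - D[W₃₁] - 3D[K₂²] + 4D[L₃]` and the converse of `apply_weight_four` are derived.
-/

noncomputable section

open Literature.NumberTheory.Transcendental

namespace Summit.KontsevichZagierPeriods.FurushoPentagon.PentagonInKZNegative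

open Summit.KontsevichZagierPeriods.KontsevichZagierPeriods.Theses.FurushoPentagon (PentagonInKZ)

/-! ## §18d The weight-4 elements and the linearised level-4 identity -/

section DK4

open DrinfeldKohnoTrunc

variable {R : Type} [CommRing R] {N : ℕ}

/-- `[A,[A,[A,B]]] = AAAB - 3AABA + 3ABAA - BAAA`. [folklore] -/
def KL1 (A B : DrinfeldKohnoTrunc R (Fin 4) N) : DrinfeldKohnoTrunc R (Fin 4) N :=
  A * A * A * B - (3 : R) • (A * A * B * A) + (3 : R) • (A * B * A * A) - B * A * A * A

/-- The `α₃₁`-pattern `AABB - 2ABBA - 2BAAB + 4BABA - BBAA`. [folklore] -/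
def K31 (A B : DrinfeldKohnoTrunc R (Fin 4) N) : DrinfeldKohnoTrunc R (Fin 4) N :=
  A * A * B * B - (2 : R) • (A * B * B * A) - (2 : R) • (B * A * A * B) + (4 : R) • (B * A * B * A) -
    B * B * A * A

/-- `[A,B]² = ABAB - ABBA - BAAB + BABA`. [folklore] -/
def K22 (A B : DrinfeldKohnoTrunc R (Fin 4) N) : DrinfeldKohnoTrunc R (Fin 4) N :=
  A * B * A * B - A * B * B * A - B * A * A * B + B * A * B * A

/-- `[[[A,B],B],B] = ABBB - 3BABB + 3BBAB - BBBA`. [folklore] -/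
def KL3 (A B : DrinfeldKohnoTrunc R (Fin 4) N) : DrinfeldKohnoTrunc R (Fin 4) N :=
  A * B * B * B - (3 : R) • (B * A * B * B) + (3 : R) • (B * B * A * B) - B * B * B * A

variable (R N) in
/-- **The quadratic cross term of the level-4 pentagon identity**:
`X = K₂¹K₂² - K₂³K₂⁴ - K₂³K₂⁵ - K₂⁴K₂⁵` (`K₂ⁱ = [Aᵢ,Bᵢ]` for the five substitutions). [cite: BarNatan1998, §3] -/
def pentX : DrinfeldKohnoTrunc R (Fin 4) N :=
  K₂ (t R N 0 1) (t R N 1 2 + t R N 1 3) * K₂ (t R N 0 2 + t R N 1 2) (t R N 2 3) -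
    K₂ (t R N 1 2) (t R N 2 3) * K₂ (t R N 0 1 + t R N 0 2) (t R N 1 3 + t R N 2 3) -
    K₂ (t R N 1 2) (t R N 2 3) * K₂ (t R N 0 1) (t R N 1 2) -
    K₂ (t R N 0 1 + t R N 0 2) (t R N 1 3 + t R N 2 3) * K₂ (t R N 0 1) (t R N 1 2)

/-- Products of three weight-one elements have weight `≥ 3`. [folklore] -/
theorem mul_mul_mem_wFil_three {X Y W : DrinfeldKohnoTrunc R (Fin 4) N}
    (hX : X ∈ (wFil 1 : Submodule R (DrinfeldKohnoTrunc R (Fin 4) N)))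
    (hY : Y ∈ (wFil 1 : Submodule R (DrinfeldKohnoTrunc R (Fin 4) N)))
    (hW : W ∈ (wFil 1 : Submodule R (DrinfeldKohnoTrunc R (Fin 4) N))) :
    X * Y * W ∈ (wFil 3 : Submodule R (DrinfeldKohnoTrunc R (Fin 4) N)) := by
  have h3 := mul_mem_wFil (mul_mem_wFil hX hY) hW
  exact h3

/-- Products of four weight-one elements have weight `≥ 3`. [folklore] -/
theorem mul_mul_mul_mem_wFil_three {X Y W V : DrinfeldKohnoTrunc R (Fin 4) N}
    (hX : X ∈ (wFil 1 : Submodule R (DrinfeldKohnoTrunc R (Fin 4) N)))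
    (hY : Y ∈ (wFil 1 : Submodule R (DrinfeldKohnoTrunc R (Fin 4) N)))
    (hW : W ∈ (wFil 1 : Submodule R (DrinfeldKohnoTrunc R (Fin 4) N)))
    (hV : V ∈ (wFil 1 : Submodule R (DrinfeldKohnoTrunc R (Fin 4) N))) :
    X * Y * W * V ∈ (wFil 3 : Submodule R (DrinfeldKohnoTrunc R (Fin 4) N)) := by
  have h4 := mul_mem_wFil (mul_mem_wFil (mul_mem_wFil hX hY) hW) hV
  exact wFil_antitone (m := 3) (n := 1 + 1 + 1 + 1) (by norm_num) h4

/-- The higher part `p·U + q·V + α₁L₁ + α₃₁W₃₁ + α₂₂K₂² + α₂₁₁L₃` of weight-one `A, B` has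
weight `≥ 3`. [folklore] -/
theorem higher_mem_wFil_three (p q a1 a31 a22 a211 : R) {A B : DrinfeldKohnoTrunc R (Fin 4) N}
    (hA : A ∈ (wFil 1 : Submodule R (DrinfeldKohnoTrunc R (Fin 4) N)))
    (hB : B ∈ (wFil 1 : Submodule R (DrinfeldKohnoTrunc R (Fin 4) N))) :
    p • KU A B + q • KV A B + a1 • KL1 A B + a31 • K31 A B + a22 • K22 A B + a211 • KL3 A B ∈
      (wFil 3 : Submodule R (DrinfeldKohnoTrunc R (Fin 4) N)) := by
  have m3 := fun {X Y W : DrinfeldKohnoTrunc R (Fin 4) N}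
    (hX : X ∈ (wFil 1 : Submodule R (DrinfeldKohnoTrunc R (Fin 4) N)))
    (hY : Y ∈ (wFil 1 : Submodule R (DrinfeldKohnoTrunc R (Fin 4) N)))
    (hW : W ∈ (wFil 1 : Submodule R (DrinfeldKohnoTrunc R (Fin 4) N))) => mul_mul_mem_wFil_three hX hY hW
  have m4 := fun {X Y W V : DrinfeldKohnoTrunc R (Fin 4) N}
    (hX : X ∈ (wFil 1 : Submodule R (DrinfeldKohnoTrunc R (Fin 4) N)))
    (hY : Y ∈ (wFil 1 : Submodule R (DrinfeldKohnoTrunc R (Fin 4) N)))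
    (hW : W ∈ (wFil 1 : Submodule R (DrinfeldKohnoTrunc R (Fin 4) N)))
    (hV : V ∈ (wFil 1 : Submodule R (DrinfeldKohnoTrunc R (Fin 4) N))) =>
    mul_mul_mul_mem_wFil_three hX hY hW hV
  simp only [KU, KV, KL1, K31, K22, KL3]
  refine Submodule.add_mem _ (Submodule.add_mem _ (Submodule.add_mem _ (Submodule.add_mem _
    (Submodule.add_mem _ (Submodule.smul_mem _ _ ?_) (Submodule.smul_mem _ _ ?_))
    (Submodule.smul_mem _ _ ?_)) (Submodule.smul_mem _ _ ?_)) (Submodule.smul_mem _ _ ?_))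
    (Submodule.smul_mem _ _ ?_)
  · exact Submodule.add_mem _ (Submodule.sub_mem _ (Submodule.sub_mem _ (m3 hA hA hB) (m3 hA hB hA))
      (m3 hA hB hA)) (m3 hB hA hA)
  · exact Submodule.add_mem _ (Submodule.sub_mem _ (Submodule.sub_mem _ (m3 hA hB hB) (m3 hB hA hB))
      (m3 hB hA hB)) (m3 hB hB hA)
  · exact Submodule.sub_mem _ (Submodule.add_mem _ (Submodule.sub_mem _ (m4 hA hA hA hB)
      (Submodule.smul_mem _ _ (m4 hA hA hB hA))) (Submodule.smul_mem _ _ (m4 hA hB hA hA))) (m4 hB hA hA hA)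
  · exact Submodule.sub_mem _ (Submodule.add_mem _ (Submodule.sub_mem _ (Submodule.sub_mem _ (m4 hA hA hB hB)
      (Submodule.smul_mem _ _ (m4 hA hB hB hA))) (Submodule.smul_mem _ _ (m4 hB hA hA hB)))
      (Submodule.smul_mem _ _ (m4 hB hA hB hA))) (m4 hB hB hA hA)
  · exact Submodule.add_mem _ (Submodule.sub_mem _ (Submodule.sub_mem _ (m4 hA hB hA hB) (m4 hA hB hB hA))
      (m4 hB hA hA hB)) (m4 hB hA hB hA)
  · exact Submodule.sub_mem _ (Submodule.add_mem _ (Submodule.sub_mem _ (m4 hA hB hB hB)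
      (Submodule.smul_mem _ _ (m4 hB hA hB hB))) (Submodule.smul_mem _ _ (m4 hB hB hA hB))) (m4 hB hB hB hA)

/-- `(1 + cK + r)(1 + cK' + r') = 1 + (cK + r) + (cK' + r') + c²KK'` at level `4`
for `K, K'` of weight `≥ 2` and `r, r'` of weight `≥ 3`. [folklore] -/
theorem one_add_mul_one_add_four (c : R) {K K' r r' : DrinfeldKohnoTrunc R (Fin 4) 4}
    (hK : K ∈ (wFil 2 : Submodule R (DrinfeldKohnoTrunc R (Fin 4) 4)))
    (hK' : K' ∈ (wFil 2 : Submodule R (DrinfeldKohnoTrunc R (Fin 4) 4)))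
    (hr : r ∈ (wFil 3 : Submodule R (DrinfeldKohnoTrunc R (Fin 4) 4)))
    (hr' : r' ∈ (wFil 3 : Submodule R (DrinfeldKohnoTrunc R (Fin 4) 4))) :
    (1 + (c • K + r)) * (1 + (c • K' + r')) =
      1 + ((c • K + r) + (c • K' + r')) + (c * c) • (K * K') := by
  have z1 : K * r' = 0 := mul_eq_zero_of_wFil (show 4 < 2 + 3 by norm_num) hK hr'
  have z2 : r * K' = 0 := mul_eq_zero_of_wFil (show 4 < 3 + 2 by norm_num) hr hK'
  have z3 : r * r' = 0 := mul_eq_zero_of_wFil (show 4 < 3 + 3 by norm_num) hr hr'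
  have e : (1 + (c • K + r)) * (1 + (c • K' + r')) = 1 + ((c • K + r) + (c • K' + r')) +
      ((c * c) • (K * K') + c • (K * r') + c • (r * K') + r * r') := by
    simp only [mul_add, add_mul, one_mul, mul_one, smul_mul_assoc, mul_smul_comm, smul_smul, smul_add]
    abel
  rw [e, z1, z2, z3]
  simp only [smul_zero, add_zero]

/-- The element `(cK + r) + (cK' + r') + c²KK'` has weight `≥ 2`. [folklore] -/
theorem sum_mem_wFil_two (c : R) {K K' r r' : DrinfeldKohnoTrunc R (Fin 4) 4}
    (hK : K ∈ (wFil 2 : Submodule R (DrinfeldKohnoTrunc R (Fin 4) 4)))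
    (hK' : K' ∈ (wFil 2 : Submodule R (DrinfeldKohnoTrunc R (Fin 4) 4)))
    (hr : r ∈ (wFil 3 : Submodule R (DrinfeldKohnoTrunc R (Fin 4) 4)))
    (hr' : r' ∈ (wFil 3 : Submodule R (DrinfeldKohnoTrunc R (Fin 4) 4))) :
    ((c • K + r) + (c • K' + r')) + (c * c) • (K * K') ∈
      (wFil 2 : Submodule R (DrinfeldKohnoTrunc R (Fin 4) 4)) := by
  have hr2 : r ∈ (wFil 2 : Submodule R (DrinfeldKohnoTrunc R (Fin 4) 4)) := wFil_antitone (by norm_num) hr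
  have hr2' : r' ∈ (wFil 2 : Submodule R (DrinfeldKohnoTrunc R (Fin 4) 4)) := wFil_antitone (by norm_num) hr'
  have hKK : K * K' ∈ (wFil 2 : Submodule R (DrinfeldKohnoTrunc R (Fin 4) 4)) := by
    have h := mul_mem_wFil hK hK'
    exact wFil_antitone (m := 2) (n := 2 + 2) (by norm_num) h
  exact Submodule.add_mem _ (Submodule.add_mem _ (Submodule.add_mem _ (Submodule.smul_mem _ _ hK) hr2)
    (Submodule.add_mem _ (Submodule.smul_mem _ _ hK') hr2')) (Submodule.smul_mem _ _ hKK)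

/-- `(1 + w)(1 + cK + r) = 1 + w + (cK + r) + c·(the weight-2 part of w)·K …` specialised:
for `w = (cK₃ + r₃) + (cK₄ + r₄) + c²K₃K₄`, `(1 + w)(1 + cK₅ + r₅) = 1 + w + (cK₅ + r₅) +
c²(K₃K₅ + K₄K₅)` at level `4`. [folklore] -/
theorem one_add_mul_third (c : R) {K₃ K₄ K₅ r₃ r₄ r₅ : DrinfeldKohnoTrunc R (Fin 4) 4}
    (hK₃ : K₃ ∈ (wFil 2 : Submodule R (DrinfeldKohnoTrunc R (Fin 4) 4)))
    (hK₄ : K₄ ∈ (wFil 2 : Submodule R (DrinfeldKohnoTrunc R (Fin 4) 4)))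
    (hK₅ : K₅ ∈ (wFil 2 : Submodule R (DrinfeldKohnoTrunc R (Fin 4) 4)))
    (hr₃ : r₃ ∈ (wFil 3 : Submodule R (DrinfeldKohnoTrunc R (Fin 4) 4)))
    (hr₄ : r₄ ∈ (wFil 3 : Submodule R (DrinfeldKohnoTrunc R (Fin 4) 4)))
    (hr₅ : r₅ ∈ (wFil 3 : Submodule R (DrinfeldKohnoTrunc R (Fin 4) 4))) :
    (1 + ((c • K₃ + r₃) + (c • K₄ + r₄)) + (c * c) • (K₃ * K₄)) * (1 + (c • K₅ + r₅)) =
      1 + ((c • K₃ + r₃) + (c • K₄ + r₄) + (c • K₅ + r₅)) +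
        (c * c) • (K₃ * K₄ + K₃ * K₅ + K₄ * K₅) := by
  have z35 : K₃ * r₅ = 0 := mul_eq_zero_of_wFil (show 4 < 2 + 3 by norm_num) hK₃ hr₅
  have z45 : K₄ * r₅ = 0 := mul_eq_zero_of_wFil (show 4 < 2 + 3 by norm_num) hK₄ hr₅
  have zr3K : r₃ * K₅ = 0 := mul_eq_zero_of_wFil (show 4 < 3 + 2 by norm_num) hr₃ hK₅
  have zr4K : r₄ * K₅ = 0 := mul_eq_zero_of_wFil (show 4 < 3 + 2 by norm_num) hr₄ hK₅
  have zr3r : r₃ * r₅ = 0 := mul_eq_zero_of_wFil (show 4 < 3 + 3 by norm_num) hr₃ hr₅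
  have zr4r : r₄ * r₅ = 0 := mul_eq_zero_of_wFil (show 4 < 3 + 3 by norm_num) hr₄ hr₅
  have zKKK : K₃ * K₄ * K₅ = 0 :=
    mul_eq_zero_of_wFil (show 4 < (2 + 2) + 2 by norm_num) (mul_mem_wFil hK₃ hK₄) hK₅
  have zKKr : K₃ * K₄ * r₅ = 0 :=
    mul_eq_zero_of_wFil (show 4 < (2 + 2) + 3 by norm_num) (mul_mem_wFil hK₃ hK₄) hr₅
  have e : (1 + ((c • K₃ + r₃) + (c • K₄ + r₄)) + (c * c) • (K₃ * K₄)) * (1 + (c • K₅ + r₅)) =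
      1 + ((c • K₃ + r₃) + (c • K₄ + r₄) + (c • K₅ + r₅)) +
        ((c * c) • (K₃ * K₄ + K₃ * K₅ + K₄ * K₅) + (c • (K₃ * r₅) + c • (K₄ * r₅) + c • (r₃ * K₅) +
          c • (r₄ * K₅) + r₃ * r₅ + r₄ * r₅ + (c * c * c) • (K₃ * K₄ * K₅) +
          (c * c) • (K₃ * K₄ * r₅))) := by
    simp only [mul_add, add_mul, one_mul, mul_one, smul_mul_assoc, mul_smul_comm, smul_smul, smul_add,
      mul_assoc]
    abel
  rw [e, z35, z45, zr3K, zr4K, zr3r, zr4r, zKKK, zKKr]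
  simp only [smul_zero, add_zero]

end DK4

/-! ### The linearised level-4 identity -/

section Level4

open DrinfeldKohnoTrunc

variable {R : Type} [CommRing R]

/-- **The level-4 pentagon identity for a series of regularised shape in weight `≤ 4`**:
`PentAt φ 4 ↔ c·D[K₂] + p·D[U] + q·D[V] + α₁·D[L₁] + α₃₁·D[W₃₁] + α₂₂·D[K₂²] + α₂₁₁·D[L₃] + c²·X = 0`
in `U𝔞₄ ⊗ R/(deg > 4)`. [cite: BarNatan1998, §3 (linearised pentagon)] -/
theorem pentAt_four_iff_of_shape {φ : NCSeries Bool R} (hφ : φ [] = 1) (h0 : φ [false] = 0)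
    (h1 : φ [true] = 0) (hff : φ [false, false] = 0) (htt : φ [true, true] = 0)
    (htf : φ [true, false] = -φ [false, true]) (hfff : φ [false, false, false] = 0)
    (httt : φ [true, true, true] = 0) (hftf : φ [false, true, false] = -2 * φ [false, false, true])
    (htff : φ [true, false, false] = φ [false, false, true])
    (htft : φ [true, false, true] = -2 * φ [false, true, true])
    (httf : φ [true, true, false] = φ [false, true, true])
    (hffff : φ [false, false, false, false] = 0) (htttt : φ [true, true, true, true] = 0)
    (hfftf : φ [false, false, true, false] = -3 * φ [false, false, false, true])
    (hftff : φ [false, true, false, false] = 3 * φ [false, false, false, true])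
    (htfff : φ [true, false, false, false] = -φ [false, false, false, true])
    (hfttf : φ [false, true, true, false] =
      -2 * φ [false, false, true, true] - φ [false, true, false, true])
    (htfft : φ [true, false, false, true] =
      -φ [false, true, false, true] - 2 * φ [false, false, true, true])
    (htftf : φ [true, false, true, false] =
      φ [false, true, false, true] + 4 * φ [false, false, true, true])
    (httff : φ [true, true, false, false] = -φ [false, false, true, true])
    (htftt : φ [true, false, true, true] = -3 * φ [false, true, true, true])
    (httft : φ [true, true, false, true] = 3 * φ [false, true, true, true])
    (htttf : φ [true, true, true, false] = -φ [false, true, true, true]) :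
    NCSeries.PentAt φ 4 ↔
      φ [false, true] • pentD R 4 K₂ + φ [false, false, true] • pentD R 4 KU +
        φ [false, true, true] • pentD R 4 KV + φ [false, false, false, true] • pentD R 4 KL1 +
        φ [false, false, true, true] • pentD R 4 K31 + φ [false, true, false, true] • pentD R 4 K22 +
        φ [false, true, true, true] • pentD R 4 KL3 + (φ [false, true] * φ [false, true]) • pentX R 4 = 0 := by
  -- abbreviations for the seven coefficients
  set c := φ [false, true] with hc
  set p := φ [false, false, true] with hp
  set q := φ [false, true, true] with hq
  set a1 := φ [false, false, false, true] with ha1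
  set a31 := φ [false, false, true, true] with ha31
  set a22 := φ [false, true, false, true] with ha22
  set a211 := φ [false, true, true, true] with ha211
  -- the expansion of one factor
  have hexp : ∀ A B : DrinfeldKohnoTrunc R (Fin 4) 4, NCSeries.evalTrunc 4 (NCSeries.bsub A B) φ =
      1 + (c • K₂ A B + (p • KU A B + q • KV A B + a1 • KL1 A B + a31 • K31 A B + a22 • K22 A B +
        a211 • KL3 A B)) := fun A B => by
    rw [evalTrunc_four_of_shape hffff htttt hfftf hftff htfff hfttf htfft htftf httff htftt httft htttf,
      evalTrunc_three_of_shape hφ h0 h1 hff htt htf hfff httt hftf htff htft httf, K₂, KU, KV, KL1, K31,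
      K22, KL3]
    module
  have hg : ∀ i j : Fin 4, t R 4 i j ∈ (wFil 1 : Submodule R (DrinfeldKohnoTrunc R (Fin 4) 4)) :=
    t_mem_wFil_one'
  have hadd : ∀ {A B : DrinfeldKohnoTrunc R (Fin 4) 4},
      A ∈ (wFil 1 : Submodule R (DrinfeldKohnoTrunc R (Fin 4) 4)) →
      B ∈ (wFil 1 : Submodule R (DrinfeldKohnoTrunc R (Fin 4) 4)) →
      A + B ∈ (wFil 1 : Submodule R (DrinfeldKohnoTrunc R (Fin 4) 4)) := fun hA hB =>
    Submodule.add_mem _ hA hB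
  have hK : ∀ {A B : DrinfeldKohnoTrunc R (Fin 4) 4},
      A ∈ (wFil 1 : Submodule R (DrinfeldKohnoTrunc R (Fin 4) 4)) →
      B ∈ (wFil 1 : Submodule R (DrinfeldKohnoTrunc R (Fin 4) 4)) →
      K₂ A B ∈ (wFil 2 : Submodule R (DrinfeldKohnoTrunc R (Fin 4) 4)) := fun hA hB =>
    Submodule.sub_mem _ (mul_mem_wFil_two' hA hB) (mul_mem_wFil_two' hB hA)
  have hr := fun {A B : DrinfeldKohnoTrunc R (Fin 4) 4}
      (hA : A ∈ (wFil 1 : Submodule R (DrinfeldKohnoTrunc R (Fin 4) 4)))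
      (hB : B ∈ (wFil 1 : Submodule R (DrinfeldKohnoTrunc R (Fin 4) 4))) =>
    higher_mem_wFil_three p q a1 a31 a22 a211 hA hB
  -- the five pairs
  have hA1 := hg 0 1
  have hB1 := hadd (hg 1 2) (hg 1 3)
  have hA2 := hadd (hg 0 2) (hg 1 2)
  have hB2 := hg 2 3
  have hA3 := hg 1 2
  have hB3 := hg 2 3
  have hA4 := hadd (hg 0 1) (hg 0 2)
  have hB4 := hadd (hg 1 3) (hg 2 3)
  have hA5 := hg 0 1
  have hB5 := hg 1 2
  dsimp only [NCSeries.PentAt, NCSeries.subst₂, NCSeries.t₄]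
  rw [hexp, hexp, hexp, hexp, hexp,
    one_add_mul_one_add_four c (hK hA1 hB1) (hK hA2 hB2) (hr hA1 hB1) (hr hA2 hB2),
    one_add_mul_one_add_four c (hK hA3 hB3) (hK hA4 hB4) (hr hA3 hB3) (hr hA4 hB4),
    one_add_mul_third c (hK hA3 hB3) (hK hA4 hB4) (hK hA5 hB5) (hr hA3 hB3) (hr hA4 hB4) (hr hA5 hB5),
    ← sub_eq_zero]
  refine Eq.congr_left ?_
  simp only [pentD, pentX, smul_add, smul_sub]
  abel

/-! ## §18e The universal identities among the level-4 elements -/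

/-- Naturality of `L₁` under algebra maps. [folklore] -/
theorem map_KL1 {N : ℕ} (σ : DrinfeldKohnoTrunc R (Fin 4) N →ₐ[R] DrinfeldKohnoTrunc R (Fin 4) N)
    (A B : DrinfeldKohnoTrunc R (Fin 4) N) : σ (KL1 A B) = KL1 (σ A) (σ B) := by
  simp only [KL1, map_sub, map_add, map_mul, _root_.map_smul]

/-- Naturality of `W₃₁` under algebra maps. [folklore] -/
theorem map_K31 {N : ℕ} (σ : DrinfeldKohnoTrunc R (Fin 4) N →ₐ[R] DrinfeldKohnoTrunc R (Fin 4) N)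
    (A B : DrinfeldKohnoTrunc R (Fin 4) N) : σ (K31 A B) = K31 (σ A) (σ B) := by
  simp only [K31, map_sub, map_add, map_mul, _root_.map_smul]

/-- Naturality of `K₂²` under algebra maps. [folklore] -/
theorem map_K22 {N : ℕ} (σ : DrinfeldKohnoTrunc R (Fin 4) N →ₐ[R] DrinfeldKohnoTrunc R (Fin 4) N)
    (A B : DrinfeldKohnoTrunc R (Fin 4) N) : σ (K22 A B) = K22 (σ A) (σ B) := by
  simp only [K22, map_sub, map_add, map_mul]

/-- Naturality of `L₃` under algebra maps. [folklore] -/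
theorem map_KL3 {N : ℕ} (σ : DrinfeldKohnoTrunc R (Fin 4) N →ₐ[R] DrinfeldKohnoTrunc R (Fin 4) N)
    (A B : DrinfeldKohnoTrunc R (Fin 4) N) : σ (KL3 A B) = KL3 (σ A) (σ B) := by
  simp only [KL3, map_sub, map_add, map_mul, _root_.map_smul]

/-- Naturality of `U`, `V`, `K₂` under algebra maps. [folklore] -/
theorem map_KU' {N : ℕ} (σ : DrinfeldKohnoTrunc R (Fin 4) N →ₐ[R] DrinfeldKohnoTrunc R (Fin 4) N)
    (A B : DrinfeldKohnoTrunc R (Fin 4) N) : σ (KU A B) = KU (σ A) (σ B) ∧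
      σ (KV A B) = KV (σ A) (σ B) ∧ σ (K₂ A B) = K₂ (σ A) (σ B) := by
  refine ⟨?_, ?_, ?_⟩ <;> simp only [KU, KV, K₂, map_sub, map_add, map_mul]

/-- Homogeneity of the weight-3 and weight-4 patterns. [folklore] -/
theorem smul_patterns {N : ℕ} (c : R) (A B : DrinfeldKohnoTrunc R (Fin 4) N) :
    K₂ (c • A) (c • B) = (c * c) • K₂ A B ∧ KU (c • A) (c • B) = (c * c * c) • KU A B ∧
      KV (c • A) (c • B) = (c * c * c) • KV A B ∧ KL1 (c • A) (c • B) = (c * c * c * c) • KL1 A B ∧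
      K31 (c • A) (c • B) = (c * c * c * c) • K31 A B ∧ K22 (c • A) (c • B) = (c * c * c * c) • K22 A B ∧
      KL3 (c • A) (c • B) = (c * c * c * c) • KL3 A B := by
  refine ⟨?_, ?_, ?_, ?_, ?_, ?_, ?_⟩ <;>
    simp only [K₂, KU, KV, KL1, K31, K22, KL3, smul_mul_assoc, mul_smul_comm, smul_smul] <;> module

/-- **Weight separation**: the scaling endomorphism `σ_c` multiplies the defect functional of a
homogeneous pattern of degree `d` by `c^d`. [folklore] -/
theorem scale_pentD {N : ℕ} {c : R} (σ : DrinfeldKohnoTrunc R (Fin 4) N →ₐ[R] DrinfeldKohnoTrunc R (Fin 4) N)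
    (hσ : ∀ i j, σ (t R N i j) = c • t R N i j)
    (K : DrinfeldKohnoTrunc R (Fin 4) N → DrinfeldKohnoTrunc R (Fin 4) N → DrinfeldKohnoTrunc R (Fin 4) N)
    (e : R) (hmap : ∀ A B, σ (K A B) = K (σ A) (σ B)) (hsmul : ∀ A B, K (c • A) (c • B) = e • K A B) :
    σ (pentD R N K) = e • pentD R N K := by
  have hσ2 : ∀ i j k l, σ (t R N i j + t R N k l) = c • (t R N i j + t R N k l) := by
    intros; rw [map_add, hσ, hσ, smul_add]
  simp only [pentD, map_sub, map_add]
  simp only [hmap]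
  simp only [hσ2, hσ]
  simp only [hsmul]
  simp only [smul_sub, smul_add]

/-- The scaling endomorphism on the cross term: `σ_c X = c⁴ X`. [folklore] -/
theorem scale_pentX {N : ℕ} {c : R} (σ : DrinfeldKohnoTrunc R (Fin 4) N →ₐ[R] DrinfeldKohnoTrunc R (Fin 4) N)
    (hσ : ∀ i j, σ (t R N i j) = c • t R N i j) : σ (pentX R N) = (c * c * c * c) • pentX R N := by
  have hK2 : ∀ A B, σ (K₂ A B) = K₂ (σ A) (σ B) := fun A B => (map_KU' σ A B).2.2
  have hs : ∀ A B : DrinfeldKohnoTrunc R (Fin 4) N, K₂ (c • A) (c • B) = (c * c) • K₂ A B := fun A B =>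
    (smul_patterns c A B).1
  have hσ2 : ∀ i j k l, σ (t R N i j + t R N k l) = c • (t R N i j + t R N k l) := by
    intros; rw [map_add, hσ, hσ, smul_add]
  simp only [pentX, map_sub, map_mul]
  simp only [hK2]
  simp only [hσ2, hσ]
  simp only [hs]
  simp only [smul_mul_assoc, mul_smul_comm, smul_smul, smul_sub, mul_assoc]

end Level4


end Summit.KontsevichZagierPeriods.FurushoPentagon.PentagonInKZNegative
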